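import Mathlib
import HarnessLib
import Literature.Probability.Entropy.BinaryRelativeEntropy
import Literature.InformationTheory.Entropy.GibbsInequality
import Literature.Probability.MarkovChains.TotalVariation

/-!
# Pinsker's inequality with the sharp constant: `2 · TV(P, Q)² ≤ D(P ‖ Q)` (finite laws)

[cite: PolyanskiyWu2024, Thm 7.10] (eq. (7.27): `D(P‖Q) ≥ (2 log e) · TV²(P, Q)`, i.e.
`2 · TV² ≤ D` in nats), proved as in the book: the binary case `d(p‖q) ≥ 2 (p − q)²`
(`two_mul_sq_sub_le_binaryKL`; the book integrates `d(p‖q) = ∫_q^p (p − t)/(t(1 − t)) dt ≥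
4 ∫_q^p (p − t) dt`, here phrased as monotonicity of `t ↦ d(a‖t) − 2(t − a)²` via the tree's
`hasDerivAt_binaryKL`), then data processing to the event `{Q ≤ P}` (the tree's
`binaryKL_le_sum_mul_log_div`) which realises the total variation distance
(`tvDist_eq_sum_filter` of `MarkovChains/TotalVariation.lean`): `two_mul_tvDist_sq_le_kl`.

The tree already had the Dewan–Muirhead / Hutchcroft form `(a − b)² ≤ 2 · kl(a‖b) · max{a, b}`
(`sq_sub_le_two_mul_binaryKL_mul_max`, `sq_sub_le_two_mul_kl_mul_max`), whose constant is
weaker by a factor up to `4 · max`; this file adds the classical constant `2`, which is sharp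
(ibid., remark after (7.27): `P_n = Ber(1/2 + 1/n)`, `Q_n = Ber(1/2)`).  Finite state space,
strictly positive laws summing to `1`; the KL divergence is written as the finite sum
`Σ_x P x · log (P x / Q x)` (natural logarithm).  Landed for the venture `LatticeQCDFlow`
(cell pub-lqcd), whose block-defect volume law uses it per block; the proofs are the theory
seat's (HOME/THEORY-2-Sketch.lean v1.1, elementary real analysis).
-/

namespace Literature.Probability.Entropy

open Finset Real
open Literature.Probability.MarkovChains

variable {X : Type*} [Fintype X] [DecidableEq X]

omit [Fintype X] [DecidableEq X] in
/-- **Binary Pinsker inequality, sharp constant** [cite: PolyanskiyWu2024, Thm 7.10] (proof,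
binary case: `d(p‖q) ≥ 2 (p − q)²`).  For `a, b ∈ (0,1)`, `2 (a − b)² ≤ kl(a ‖ b)`.  Proof:
`h(t) = kl(a‖t) − 2(t−a)²` vanishes at `t = a` and `h'(t) = (t − a)(1 − 2t)²/(t(1−t))` has the
sign of `t − a`. -/
theorem two_mul_sq_sub_le_binaryKL {a b : ℝ} (ha : 0 < a) (ha1 : a < 1) (hb : 0 < b)
    (hb1 : b < 1) : 2 * (a - b) ^ 2 ≤ binaryKL a b := by
  set h : ℝ → ℝ := fun t => binaryKL a t - 2 * (t - a) ^ 2 with hh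
  have hderiv : ∀ t ∈ Set.Ioo (0:ℝ) 1, HasDerivAt h
      ((-a / t + (1 - a) / (1 - t)) - 2 * (2 * (t - a))) t := by
    intro t ht
    have h2 : HasDerivAt (fun t => 2 * (t - a) ^ 2) (2 * (2 * (t - a))) t := by
      have hsq : HasDerivAt (fun t => (t - a) ^ 2) (2 * (t - a)) t := by
        have h1 := ((hasDerivAt_id t).sub_const a).mul ((hasDerivAt_id t).sub_const a)
        refine (h1.congr_of_eventuallyEq (Filter.Eventually.of_forall fun s => ?_)).congr_deriv ?_
        · simp [pow_two]
        · simp; ring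
      exact hsq.const_mul 2
    exact (hasDerivAt_binaryKL a ht.1 ht.2).sub h2
  have hderiv_eq : ∀ t ∈ Set.Ioo (0:ℝ) 1,
      (-a / t + (1 - a) / (1 - t)) - 2 * (2 * (t - a)) = (t - a) * ((1 - 2 * t) ^ 2 / (t * (1 - t))) := by
    intro t ht
    have ht0 : t ≠ 0 := ht.1.ne'
    have ht1 : (1:ℝ) - t ≠ 0 := by linarith [ht.2]
    field_simp
    ring
  have hcont : ContinuousOn h (Set.Ioo 0 1) :=
    fun t ht => (hderiv t ht).continuousAt.continuousWithinAt
  have h0 : h a = 0 := by simp [hh]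
  rcases lt_trichotomy a b with hab | rfl | hba
  · -- monotone on [a, b]
    have hsub : Set.Icc a b ⊆ Set.Ioo 0 1 := fun t ht => ⟨ha.trans_le ht.1, ht.2.trans_lt hb1⟩
    have hmono : MonotoneOn h (Set.Icc a b) := by
      refine monotoneOn_of_deriv_nonneg (convex_Icc a b) (hcont.mono hsub) ?_ ?_
      · rw [interior_Icc]
        exact fun t ht => (hderiv t (hsub (Set.Ioo_subset_Icc_self ht))).differentiableAt.differentiableWithinAt
      · rw [interior_Icc]
        intro t ht
        have ht' : t ∈ Set.Ioo (0:ℝ) 1 := hsub (Set.Ioo_subset_Icc_self ht)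
        rw [(hderiv t ht').deriv, hderiv_eq t ht']
        have hta : 0 ≤ t - a := by linarith [ht.1]
        have : 0 ≤ (1 - 2 * t) ^ 2 / (t * (1 - t)) := by
          apply div_nonneg (sq_nonneg _)
          exact (mul_pos ht'.1 (by linarith [ht'.2])).le
        exact mul_nonneg hta this
    have hab' := hmono (Set.left_mem_Icc.2 hab.le) (Set.right_mem_Icc.2 hab.le) hab.le
    rw [h0] at hab'
    have : 0 ≤ binaryKL a b - 2 * (b - a) ^ 2 := hab'
    nlinarith [this]
  · simp
  · -- antitone on [b, a]
    have hsub : Set.Icc b a ⊆ Set.Ioo 0 1 := fun t ht => ⟨hb.trans_le ht.1, ht.2.trans_lt ha1⟩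
    have hanti : AntitoneOn h (Set.Icc b a) := by
      refine antitoneOn_of_deriv_nonpos (convex_Icc b a) (hcont.mono hsub) ?_ ?_
      · rw [interior_Icc]
        exact fun t ht => (hderiv t (hsub (Set.Ioo_subset_Icc_self ht))).differentiableAt.differentiableWithinAt
      · rw [interior_Icc]
        intro t ht
        have ht' : t ∈ Set.Ioo (0:ℝ) 1 := hsub (Set.Ioo_subset_Icc_self ht)
        rw [(hderiv t ht').deriv, hderiv_eq t ht']
        have hta : t - a ≤ 0 := by linarith [ht.2]
        have : 0 ≤ (1 - 2 * t) ^ 2 / (t * (1 - t)) := by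
          apply div_nonneg (sq_nonneg _)
          exact (mul_pos ht'.1 (by linarith [ht'.2])).le
        exact mul_nonpos_of_nonpos_of_nonneg hta this
    have hba' := hanti (Set.left_mem_Icc.2 hba.le) (Set.right_mem_Icc.2 hba.le) hba.le
    rw [h0] at hba'
    have : 0 ≤ binaryKL a b - 2 * (b - a) ^ 2 := hba'
    nlinarith [this]

/-- **Pinsker's inequality, sharp constant** [cite: PolyanskiyWu2024, Thm 7.10] (eq. (7.27) in
nats).  For laws `P, Q > 0` on a finite space with `Σ P = Σ Q = 1`:
`2 ‖P − Q‖_TV² ≤ D_KL(P ‖ Q) = Σ_x P x log (P x / Q x)`.  Via data processing to the event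
`{Q ≤ P}` (tree: `binaryKL_le_sum_mul_log_div`), which attains the total variation distance
(`tvDist_eq_sum_filter`), and the binary case `two_mul_sq_sub_le_binaryKL`. -/
theorem two_mul_tvDist_sq_le_kl {P Q : X → ℝ} (hP : ∀ x, 0 < P x)
    (hQ : ∀ x, 0 < Q x) (hP1 : ∑ x, P x = 1) (hQ1 : ∑ x, Q x = 1) :
    2 * tvDist P Q ^ 2 ≤ ∑ x, P x * Real.log (P x / Q x) := by
  have hKL0 : 0 ≤ ∑ x, P x * Real.log (P x / Q x) :=
    Literature.InformationTheory.Entropy.sum_mul_log_div_nonneg (fun x => (hP x).le) hQ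
      (by rw [hP1, hQ1])
  set A := univ.filter (fun x => Q x ≤ P x) with hA
  have htv : tvDist P Q = ∑ x ∈ A, P x - ∑ x ∈ A, Q x := by
    rw [tvDist_eq_sum_filter (by rw [hP1, hQ1]), sum_sub_distrib]
  set a := ∑ x ∈ A, P x with ha_def
  set b := ∑ x ∈ A, Q x with hb_def
  have hKLA : binaryKL a b ≤ ∑ x, P x * Real.log (P x / Q x) :=
    binaryKL_le_sum_mul_log_div univ A (subset_univ A) P Q (fun x _ => (hP x).le)
      (fun x _ => hQ x) hP1 hQ1
  -- degenerate events: `A = ∅` or `A = univ` force `‖P − Q‖_TV = 0`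
  by_cases hAe : A = ∅
  · have : tvDist P Q = 0 := by rw [htv, ha_def, hb_def, hAe]; simp
    rw [this]; simpa using hKL0
  by_cases hAu : A = univ
  · have : tvDist P Q = 0 := by rw [htv, ha_def, hb_def, hAu, hP1, hQ1]; simp
    rw [this]; simpa using hKL0
  -- otherwise `a, b ∈ (0,1)`
  have hAne : A.Nonempty := nonempty_iff_ne_empty.2 hAe
  have hAc : (Aᶜ).Nonempty := by
    rw [nonempty_iff_ne_empty, Ne, compl_eq_empty_iff]; exact hAu
  have ha0 : 0 < a := sum_pos (fun x _ => hP x) hAne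
  have hb0 : 0 < b := sum_pos (fun x _ => hQ x) hAne
  have ha1 : a < 1 := by
    have hc : 0 < ∑ x ∈ Aᶜ, P x := sum_pos (fun x _ => hP x) hAc
    have := sum_add_sum_compl A P
    linarith
  have hb1 : b < 1 := by
    have hc : 0 < ∑ x ∈ Aᶜ, Q x := sum_pos (fun x _ => hQ x) hAc
    have := sum_add_sum_compl A Q
    linarith
  have hpin := two_mul_sq_sub_le_binaryKL ha0 ha1 hb0 hb1
  rw [htv]
  linarith

end Literature.Probability.Entropy
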